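import Literature.AlgebraicGeometry.Motives.KaehlerFormPowFrameProofs
import Literature.Geometry.Kaehler.TwoFormPowers
import HarnessLib

/-!
# Wedge powers of a `2`-form on a weighted pair frame: `Aʳ(u₀, w₀, …) = r! ∏ cᵢ`

The pointwise linear algebra of [VoisinHodgeI2002, §3.1.3 Lemma 3.8, eq. (3.2)]
(`ωⁿ(e₁, Je₁, …, eₙ, Jeₙ) = n!`, proved in the tree for the powers `kaehlerFormPow g r` of the
Kähler form of a Riemannian metric, `Literature.AlgebraicGeometry.Motives.kaehlerFormPow_apply_pairFrame`),
for the wedge powers `A.twoPow r` (`Literature/Geometry/Kaehler/TwoFormPowers.lean`) of an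
ARBITRARY real `2`-covector `A` and with WEIGHTS: if `A(uᵢ, uⱼ) = 0`, `A(wᵢ, wⱼ) = 0` and
`A(uᵢ, wⱼ) = δᵢⱼ cᵢ` (`i, j < r`), then

  `Aʳ(u₀, w₀, u₁, w₁, …, u_{r-1}, w_{r-1}) = r! · c₀ c₁ ⋯ c_{r-1}`

(`twoPow_apply_pairFrame`). With `A = dd^c w` restricted to a complex `p`-plane, `uᵢ` a unitary
frame diagonalising the Levi form of `w` there and `wᵢ = i uᵢ`, this evaluates the Monge–Ampère
density `(dd^c w)ᵖ` on the complex frame as `p! ∏ (2λᵢ)`, `λᵢ ≥ 0` the Levi eigenvalues — the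
positivity and the determinant formula for `[A] ∧ (dd^c w)ᵖ` on a holomorphic chain
[Chirka1989, §13.2, §15.1]; [Demailly, Ch. III §1]. The proof is the tree's induction through the
subset shuffle formula `(Aʳ ∧ A)(f) = Σ_{a<b} ± Aʳ(f ∖ {a,b}) A(f_a, f_b)`
(`Literature.Geometry.Kaehler.wedge_apply_eq_sum_powersetCard`) and its pair-complement
combinatorics (`exists_powersetCard_pairCompl`, `sign_blockPerm_one_of_pairCompl`,
`interleave_comp_enum_of_pairCompl`), carrying the weights along.

Theorems only.

## References

* C. Voisin, *Hodge Theory and Complex Algebraic Geometry I*, CUP 2002, §3.1.3 Lemma 3.8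
  [VoisinHodgeI2002].
* E. M. Chirka, *Complex Analytic Sets*, Kluwer 1989, §13.2 [Chirka1989].
-/

noncomputable section

open Module ContinuousAlternatingMap Function Set.powersetCard
open Literature.Geometry.Kaehler Literature.Geometry.Kaehler.HodgeStarAux
open Literature.AlgebraicGeometry.Motives

namespace Literature.Geometry.Kaehler

namespace TwoForm

variable {E : Type*} [NormedAddCommGroup E] [NormedSpace ℝ E]

/-- `A^0 = 1` evaluates to `1` on the empty frame. [folklore] -/
theorem twoPow_zero_apply (A : E [⋀^Fin 2]→L[ℝ] ℝ) (v : Fin (2 * 0) → E) : A.twoPow 0 v = 1 := rfl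

/-- `A^{r+1}(v) = (A^r ∧ A)(v)` (the degree cast in the recursion of `twoPow` is definitional).
[folklore] -/
theorem twoPow_succ_apply (A : E [⋀^Fin 2]→L[ℝ] ℝ) (r : ℕ) (v : Fin (2 * r + 2) → E) :
    A.twoPow (r + 1) v = (A.twoPow r).wedge A v := rfl

/-- Deleting the index `j` from a product over `Fin (r + 1)`:
`c j · ∏_{i<r} c (skip_j i) = ∏_{i<r+1} c i`, `skip_j i = i` for `i < j` and `i + 1` otherwise.
[folklore] -/
theorem mul_prod_skip_eq_prod (c : ℕ → ℝ) {r : ℕ} (j : Fin (r + 1)) :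
    c j * ∏ i : Fin r, c (if (i : ℕ) < j then i else i + 1) = ∏ i : Fin (r + 1), c i := by
  rw [Fin.prod_univ_succAbove (fun i : Fin (r + 1) => c i) j]
  congr 1
  refine Finset.prod_congr rfl fun i _ => ?_
  congr 1
  rw [Fin.succAbove]
  split_ifs with h1 h2 h2
  · rfl
  · exfalso; exact h2 (by simpa [Fin.lt_def] using h1)
  · exfalso; exact h1 (by simpa [Fin.lt_def] using h2)
  · rfl

/-- **Wedge powers on a weighted pair frame** (Voisin's (3.2) with weights): for a real `2`-covector
`A`, sequences `u, w` and weights `c` with `A(uᵢ, uⱼ) = 0`, `A(wᵢ, wⱼ) = 0`, `A(uᵢ, wⱼ) = δᵢⱼ cᵢ`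
for `i, j < r`, the interleaved frame `(u₀, w₀, u₁, w₁, …)` satisfies
`Aʳ(u₀, w₀, …, u_{r-1}, w_{r-1}) = r! ∏_{i<r} cᵢ`. [cite: VoisinHodgeI2002, §3.1.3 Lemma 3.8 eq. (3.2)] -/
theorem twoPow_apply_pairFrame (A : E [⋀^Fin 2]→L[ℝ] ℝ) (r : ℕ) (u w : ℕ → E) (c : ℕ → ℝ)
    (huu : ∀ i j, i < r → j < r → A ![u i, u j] = 0)
    (hww : ∀ i j, i < r → j < r → A ![w i, w j] = 0)
    (huw : ∀ i j, i < r → j < r → A ![u i, w j] = if i = j then c i else 0) :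
    A.twoPow r (fun i : Fin (2 * r) ↦ if (i : ℕ) % 2 = 0 then u (i / 2) else w (i / 2)) =
      r.factorial * ∏ i : Fin r, c i := by
  induction r generalizing u w c with
  | zero =>
    rw [Nat.factorial_zero, Nat.cast_one, Finset.univ_eq_empty, Finset.prod_empty, mul_one]
    rfl
  | succ r ih =>
    set α : E [⋀^Fin (2 * r)]→L[ℝ] ℝ := A.twoPow r with hαdef
    rw [show A.twoPow (r + 1)
        (fun i : Fin (2 * (r + 1)) ↦ if (i : ℕ) % 2 = 0 then u (i / 2) else w (i / 2)) =
      α.wedge A (fun i : Fin (2 * r + 2) ↦ if (i : ℕ) % 2 = 0 then u (i / 2) else w (i / 2))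
      from rfl]
    rw [wedge_apply_eq_sum_powersetCard]
    -- the pair complements, indexed by the pair
    have hex : ∀ jj : Fin (r + 1), ∃ s : Set.powersetCard (Fin (2 * r + 2)) (2 * r),
        ∀ x : Fin (2 * r + 2), x ∈ s ↔ (x : ℕ) ≠ 2 * (jj : ℕ) ∧ (x : ℕ) ≠ 2 * (jj : ℕ) + 1 :=
      fun jj ↦ exists_powersetCard_pairCompl (r := r) jj (Nat.le_of_lt_succ jj.2)
    choose P hP using hex
    have hPinj : Injective P := fun j₁ j₂ h ↦ Fin.ext
      (eq_of_pairCompl (Nat.le_of_lt_succ j₁.2) (hP j₁) (by rw [h]; exact hP j₂))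
    -- the contribution of the pair `j`
    set g : Fin (r + 1) → ℝ := fun jj ↦
      (r.factorial * ∏ i : Fin r, c (if (i : ℕ) < jj then i else i + 1)) * c jj with hg
    refine (Fintype.sum_of_injective P hPinj g _ ?_ ?_).symm.trans ?_
    · -- subsets other than pair complements do not contribute
      intro s hs
      set e := ofFinEmbEquiv.symm (Set.powersetCard.compl (card_fin_add (k := 2 * r) (m := 2)) s)
        with he
      have hab : e 0 < e 1 := e.strictMono (by decide)
      have hab' : ((e 0 : Fin (2 * r + 2)) : ℕ) < (e 1 : Fin (2 * r + 2)) := hab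
      have h1lt := (e 1).2
      have hnot : ¬ (((e 0 : Fin (2 * r + 2)) : ℕ) % 2 = 0 ∧
          ((e 1 : Fin (2 * r + 2)) : ℕ) = (e 0 : Fin (2 * r + 2)) + 1) := by
        rintro ⟨h0, h1⟩
        apply hs
        have hs' : ∀ y : Fin (2 * r + 2), y ∈ s ↔
            (y : ℕ) ≠ 2 * ((e 0 : Fin (2 * r + 2)) / 2) ∧
              (y : ℕ) ≠ 2 * ((e 0 : Fin (2 * r + 2)) / 2) + 1 := by
          intro y
          constructor
          · intro hy
            have hyt : y ∉ Set.powersetCard.compl (card_fin_add (k := 2 * r) (m := 2)) s :=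
              fun h ↦ Set.powersetCard.mem_compl.1 h hy
            rw [← mem_range_ofFinEmbEquiv_symm_iff_mem, ← he] at hyt
            have hy0 : y ≠ e 0 := fun h ↦ hyt ⟨0, h.symm⟩
            have hy1 : y ≠ e 1 := fun h ↦ hyt ⟨1, h.symm⟩
            rw [Ne, Fin.ext_iff] at hy0 hy1
            omega
          · rintro ⟨hy0, hy1⟩
            by_contra hys
            have hyt : y ∈ Set.powersetCard.compl (card_fin_add (k := 2 * r) (m := 2)) s :=
              Set.powersetCard.mem_compl.2 hys
            rw [← mem_range_ofFinEmbEquiv_symm_iff_mem, ← he] at hyt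
            obtain ⟨i, hi⟩ := hyt
            fin_cases i
            · have := congrArg Fin.val hi
              simp only [Fin.zero_eta, Fin.isValue] at this
              omega
            · have := congrArg Fin.val hi
              simp only [Fin.mk_one, Fin.isValue] at this
              omega
        refine ⟨⟨(e 0 : Fin (2 * r + 2)) / 2, by omega⟩, ?_⟩
        rw [Set.powersetCard.eq_iff_subset]
        intro y hy
        rw [Set.powersetCard.mem_coe_iff, hP] at hy
        rw [Set.powersetCard.mem_coe_iff, hs']
        exact hy
      suffices h0 : A ((fun i : Fin (2 * r + 2) ↦ if (i : ℕ) % 2 = 0 then u (i / 2) else w (i / 2)) ∘ e)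
          = 0 by
        rw [h0, mul_zero, smul_zero]
      rw [show ((fun i : Fin (2 * r + 2) ↦ if (i : ℕ) % 2 = 0 then u (i / 2) else w (i / 2)) ∘ e) =
        ![if ((e 0 : Fin (2 * r + 2)) : ℕ) % 2 = 0 then u ((e 0 : Fin (2 * r + 2)) / 2)
            else w ((e 0 : Fin (2 * r + 2)) / 2),
          if ((e 1 : Fin (2 * r + 2)) : ℕ) % 2 = 0 then u ((e 1 : Fin (2 * r + 2)) / 2)
            else w ((e 1 : Fin (2 * r + 2)) / 2)] from funext fun i ↦ by fin_cases i <;> rfl]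
      have hr0 : ((e 0 : Fin (2 * r + 2)) : ℕ) / 2 < r + 1 := by omega
      have hr1 : ((e 1 : Fin (2 * r + 2)) : ℕ) / 2 < r + 1 := by omega
      by_cases p0 : ((e 0 : Fin (2 * r + 2)) : ℕ) % 2 = 0 <;>
        by_cases p1 : ((e 1 : Fin (2 * r + 2)) : ℕ) % 2 = 0
      · rw [if_pos p0, if_pos p1]
        exact huu _ _ hr0 hr1
      · rw [if_pos p0, if_neg p1, huw _ _ hr0 hr1, if_neg]
        omega
      · rw [if_neg p0, if_pos p1, apply_vecCons_two_swap, huw _ _ hr1 hr0, if_neg, neg_zero]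
        omega
      · rw [if_neg p0, if_neg p1]
        exact hww _ _ hr0 hr1
    · -- the pair complement `P j` contributes `g j`
      intro jj
      have hjj := jj.2
      have hj : (jj : ℕ) ≤ r := Nat.le_of_lt_succ hjj
      set e := ofFinEmbEquiv.symm (Set.powersetCard.compl (card_fin_add (k := 2 * r) (m := 2))
        (P jj)) with he
      have hv0 : ((e 0 : Fin (2 * r + 2)) : ℕ) = 2 * jj := by
        have h := enum_compl_val_of_pairCompl (hP jj) 0
        rw [← he] at h
        simpa using h
      have hv1 : ((e 1 : Fin (2 * r + 2)) : ℕ) = 2 * jj + 1 := by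
        have h := enum_compl_val_of_pairCompl (hP jj) 1
        rw [← he] at h
        simpa using h
      have key : ∀ i : Fin 2,
          (fun i : Fin (2 * r + 2) ↦ if (i : ℕ) % 2 = 0 then u (i / 2) else w (i / 2)) (e i) =
            ![u jj, w jj] i := by
        rw [Fin.forall_fin_two]
        refine ⟨?_, ?_⟩
        · simp only [hv0, Fin.isValue, Matrix.cons_val_zero]
          rw [if_pos (by omega), show 2 * (jj : ℕ) / 2 = jj by omega]
        · simp only [hv1, Fin.isValue, Matrix.cons_val_one, Matrix.cons_val_fin_one]
          rw [if_neg (by omega), show (2 * (jj : ℕ) + 1) / 2 = jj by omega]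
      have hA : A ((fun i : Fin (2 * r + 2) ↦ if (i : ℕ) % 2 = 0 then u (i / 2) else w (i / 2)) ∘ e) =
          A ![u jj, w jj] := congrArg A (funext key)
      rw [sign_blockPerm_one_of_pairCompl hj (hP jj), one_smul,
        interleave_comp_enum_of_pairCompl (hP jj), hA, huw _ _ hjj hjj, if_pos rfl]
      -- the deleted frame is the interleaved frame of the re-indexed sequences
      have hih := ih (fun i ↦ if i < jj then u i else u (i + 1))
        (fun i ↦ if i < jj then w i else w (i + 1)) (fun i ↦ c (if i < jj then i else i + 1)) ?_ ?_ ?_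
      · rw [hg, hih]
      · intro i j hi hj'
        split_ifs <;> exact huu _ _ (by omega) (by omega)
      · intro i j hi hj'
        split_ifs <;> exact hww _ _ (by omega) (by omega)
      · intro i j hi hj'
        split_ifs with h1 h2 h2 <;> rw [huw _ _ (by omega) (by omega)] <;> split_ifs <;>
          first | rfl | (exfalso; omega)
    · -- sum of the contributions: `Σ_j r! (∏_{i≠j} c_i) c_j = (r+1)! ∏ c_i`
      have hsum : ∀ jj : Fin (r + 1), g jj = r.factorial * ∏ i : Fin (r + 1), c i := by
        intro jj
        rw [hg]
        simp only
        rw [mul_assoc, mul_comm (∏ i : Fin r, c (if (i : ℕ) < jj then i else i + 1)) (c jj),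
          mul_prod_skip_eq_prod c jj]
      rw [Finset.sum_congr rfl fun jj _ => hsum jj, Finset.sum_const, Finset.card_univ,
        Fintype.card_fin, Nat.factorial_succ, nsmul_eq_mul]
      push_cast
      ring

/-- **Wedge powers on a weighted complex frame**: for a real `2`-covector `A` on a complex normed
space and a complex frame `u₀, …, u_{r-1}` with `A(uᵢ, uⱼ) = 0`, `A(i uᵢ, i uⱼ) = 0`,
`A(uᵢ, i uⱼ) = δᵢⱼ cᵢ`, `Aʳ(u₀, i u₀, …, u_{r-1}, i u_{r-1}) = r! ∏ cᵢ` (the frame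
`complexFrame u` of `HolomorphicChain.lean`). For `A = dd^c w` and `u` a unitary frame
diagonalising the Levi form of `w` on `span_ℂ u` these relations hold with `cᵢ = 2λᵢ ≥ 0`.
[cite: VoisinHodgeI2002, §3.1.3 Lemma 3.8 eq. (3.2)] -/
theorem twoPow_apply_complexPairFrame {V : Type*} [NormedAddCommGroup V] [NormedSpace ℂ V]
    (A : V [⋀^Fin 2]→L[ℝ] ℝ) (r : ℕ) (u : ℕ → V) (c : ℕ → ℝ)
    (huu : ∀ i j, i < r → j < r → A ![u i, u j] = 0)
    (hJJ : ∀ i j, i < r → j < r → A ![Complex.I • u i, Complex.I • u j] = 0)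
    (huJ : ∀ i j, i < r → j < r → A ![u i, Complex.I • u j] = if i = j then c i else 0) :
    A.twoPow r (fun i : Fin (2 * r) ↦ if (i : ℕ) % 2 = 0 then u (i / 2) else Complex.I • u (i / 2)) =
      r.factorial * ∏ i : Fin r, c i :=
  twoPow_apply_pairFrame A r u (fun i => Complex.I • u i) c huu hJJ huJ

end TwoForm

end Literature.Geometry.Kaehler

end
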